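import Literature.MathematicalPhysics.QuantumFieldTheory.Chatterjee2019LargeN.PlaquetteFirstOrder
import HarnessLib

/-!
# Chatterjee 2019, §§2.2, 4, 14: unit loops — the plaquette loops in either orientation, read from any corner

S. Chatterjee, *Rigorous solution of strongly coupled `SO(N)` lattice gauge theory in the large `N` limit*,
Comm. Math. Phys. **366** (2019) 203–268 (arXiv:1502.07719).  The strong-coupling algorithm of **§4** starts from
the plaquette loop `(p)` and, along a vanishing trajectory (§2.2), passes through the loops obtained from `∂p` by the
string operations; every such trajectory ENDS with a negative deformation `u ⊖ₓ q = ∅` of a loop `u` which is the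
boundary of the plaquette `q` read from one of its four corners, in one of its two orientations — a **unit loop**
(`IsUnitLoop q u`: a rotation of the plaquette word `∂q` of §2.1 or of its inverse path `(∂q)⁻¹`).  This file is the
toolkit for such loops, used by the computation of the higher coefficients `a_k((p))` (sibling `PlaquetteThirdOrder`):

* ★ `IsUnitLoop.negDeform_eq` / `IsUnitLoop.posDeform_eq` — **the deformations by `q` at a letter that a unit loop `U`
  of `q` contains (with the same orientation) glue `U` in**: if `w` read from `x` is `f t` and `U` read from `f` is
  `f r`, then `w ⊖ₓ q = [r⁻¹ t]` and `w ⊕ₓ q = [f r f t]` (§2.2's two orientation cases of the merger formulas become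
  one statement); `wordChain` versions.
* `IsUnitLoop.negDeform_self` — `u ⊖ₓ q = ∅` at each of the four locations of a unit loop `u` of `q`;
  `IsUnitLoop.posDeform_self_ne_nil` (`r = 2r(u) ≠ 0`).
* ★ `IsUnitLoop.coeffA_one` — **`a₁((u)) = 1` for every unit loop** (generalising the tree's `coeffA_plaquette_one`, the
  printed «`a₁ = 1`» of §4, to all eight based/oriented readings of a plaquette);
  ★ `coeffA_singleton_one_eq_zero_of_wordChain` — `a₁((u)) = 0` for a genuine loop whose 1-chain is not `±δq` for any `q`
  (no single deformation of `u` is null, §14's `r`-bookkeeping); ★ `coeffA_pair_two` — `a₂((u₁, u₂)) = 1` for unit loops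
  (`= a₁a₁` by the factorization `Factorization.coeffA_append` of §13 and Lemma 11.3).
* word-level lemmas: `plaquetteWord_map_fst_nodup` (the four edges of a plaquette are distinct), `rotate_eq_rotate_of_head`
  (a duplicate-free cycle is determined by its first letter), `mem_invRev_iff`, `invRev_rotate`.

## WHAT THIS IS NOT
Pure combinatorics of Chatterjee's lattice string model; nothing here bears on four-dimensional Yang–Mills or a mass gap.

## References
* S. Chatterjee, Comm. Math. Phys. **366** (2019) 203–268, doi:10.1007/s00220-019-03353-3, arXiv:1502.07719 — §2.1
  (plaquettes, cycles «fixing the first edge by some arbitrary rule», the inverse path), §2.2 (deformations `l ⊕ₓ p`,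
  `l ⊖ₓ p`), §4 (`a₁ = 1`), Corollary 10.4, Lemma 11.3, §13, §14 (proof of Lemma 14.1).  [Chatterjee2019LargeN]
-/

noncomputable section

open Finset
open Literature.Probability.LatticeModels Literature.MathematicalPhysics.QuantumLattice

namespace Literature.MathematicalPhysics.QuantumFieldTheory.Chatterjee2019LargeN

variable {d : ℕ}

/-! ### Word-level helpers: inverse paths, rotations, duplicate-free cycles -/

/-- `f ∈ ρ⁻¹ ↔ f⁻¹ ∈ ρ`. [cite: Chatterjee2019LargeN, §2.1 (the inverse path ρ⁻¹ = eₙ⁻¹ ⋯ e₁⁻¹)] -/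
theorem mem_invRev_iff {ρ : Word d} {f : DEdge d} : f ∈ FreeGroup.invRev ρ ↔ DEdge.inv f ∈ ρ := by
  rw [invRev_eq, List.mem_reverse, List.mem_map]
  constructor
  · rintro ⟨a, ha, rfl⟩
    rwa [DEdge.inv_inv]
  · intro h
    exact ⟨DEdge.inv f, h, DEdge.inv_inv f⟩

/-- The undirected edges of `ρ⁻¹` are those of `ρ`, reversed. [cite: Chatterjee2019LargeN, §2.1 (inverse path)] -/
theorem map_fst_invRev (ρ : Word d) : (FreeGroup.invRev ρ).map Prod.fst = (ρ.map Prod.fst).reverse := by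
  rw [invRev_eq, List.map_reverse, List.map_map]
  congr 1

/-- The inverse of a rotated cycle is a rotation of the inverse cycle: `(ρ ↻ k)⁻¹ = ρ⁻¹ ↻ (n − k mod n)`.
[cite: Chatterjee2019LargeN, §2.1 (cycles and inverse paths)] -/
theorem invRev_rotate (ρ : Word d) (k : ℕ) :
    FreeGroup.invRev (ρ.rotate k) = (FreeGroup.invRev ρ).rotate (ρ.length - k % ρ.length) := by
  rw [invRev_eq, invRev_eq, List.map_rotate, List.reverse_rotate, List.length_map]

/-- A duplicate-free cycle is determined by its first letter: two rotations of a `Nodup` word with the same head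
coincide («the first edge of a cycle … by some arbitrary rule»). [cite: Chatterjee2019LargeN, §2.1 (cycles, first edge)] -/
theorem rotate_eq_rotate_of_head {ρ : Word d} (hρ : ρ.Nodup) {i j : ℕ} {a : DEdge d} {s s' : Word d}
    (hi : ρ.rotate i = a :: s) (hj : ρ.rotate j = a :: s') : ρ.rotate i = ρ.rotate j := by
  have hn : 0 < ρ.length := by
    have := congrArg List.length hi
    rw [List.length_rotate, List.length_cons] at this
    omega
  have h1 : (ρ.rotate i)[0]'(by rw [hi]; exact Nat.zero_lt_succ _) = a := by simp [hi]
  have h2 : (ρ.rotate j)[0]'(by rw [hj]; exact Nat.zero_lt_succ _) = a := by simp [hj]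
  rw [List.getElem_rotate] at h1 h2
  simp only [zero_add] at h1 h2
  have hij : i % ρ.length = j % ρ.length := (hρ.getElem_inj_iff).1 (h1.trans h2.symm)
  rw [← List.rotate_mod ρ i, hij, List.rotate_mod]

/-! ### The plaquette word: distinct edges -/

/-- The four undirected edges of the plaquette word are pairwise distinct. [cite: Chatterjee2019LargeN, §2.2 («a plaquette cannot contain an edge e or its inverse at more than one location»)] -/
theorem plaquetteWord_map_fst_nodup (q : ZdPlaquette d) : ((plaquetteWord q).map Prod.fst).Nodup := by
  obtain ⟨x, ⟨⟨i, j⟩, hij⟩⟩ := q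
  have hne : i ≠ j := ne_of_lt hij
  have h1 : ∀ k : Fin d, x + Pi.single k (1 : ℤ) ≠ x := fun k h => by
    have := congrFun h k; simp at this
  have h2 : ∀ k : Fin d, x ≠ x + Pi.single k (1 : ℤ) := fun k h => h1 k h.symm
  have h3 : x + Pi.single j (1 : ℤ) ≠ x + Pi.single i 1 := fun h => by
    have := congrFun (add_left_cancel h) i
    simp [hne] at this
  simp [plaquetteWord, hne, hne.symm, h1, h2, h3]

/-- Hence the plaquette word itself is duplicate-free. [cite: Chatterjee2019LargeN, §2.2] -/
theorem plaquetteWord_nodup (q : ZdPlaquette d) : (plaquetteWord q).Nodup :=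
  (plaquetteWord_map_fst_nodup q).of_map _

/-- … and so is its inverse path. [cite: Chatterjee2019LargeN, §2.1, §2.2] -/
theorem invRev_plaquetteWord_nodup (q : ZdPlaquette d) : (FreeGroup.invRev (plaquetteWord q)).Nodup := by
  have h : ((FreeGroup.invRev (plaquetteWord q)).map Prod.fst).Nodup := by
    rw [map_fst_invRev, List.nodup_reverse]
    exact plaquetteWord_map_fst_nodup q
  exact h.of_map _

/-- A letter of the plaquette word of `q` lies on an edge of `q`. [cite: Chatterjee2019LargeN, §2.1 (p = e₁e₂e₃⁻¹e₄⁻¹)] -/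
theorem fst_mem_plaquetteEdges_of_mem {q : ZdPlaquette d} {f : DEdge d} (hf : f ∈ plaquetteWord q) :
    f.1 ∈ plaquetteEdges q := by
  obtain ⟨x, ⟨⟨i, j⟩, hij⟩⟩ := q
  simp only [plaquetteWord, List.mem_cons, List.not_mem_nil, or_false] at hf
  rcases hf with rfl | rfl | rfl | rfl <;> simp [plaquetteEdges]

/-- Two letters of the plaquette word on the same undirected edge are equal. [cite: Chatterjee2019LargeN, §2.2 (unique location of an edge in a plaquette)] -/
theorem eq_of_mem_plaquetteWord_of_fst_eq {q : ZdPlaquette d} {a f : DEdge d} (ha : a ∈ plaquetteWord q)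
    (hf : f ∈ plaquetteWord q) (h : a.1 = f.1) : a = f :=
  List.inj_on_of_nodup_map (plaquetteWord_map_fst_nodup q) ha hf h

/-! ### Unit loops -/

/-- **Unit loops** of the plaquette `q`: the plaquette loop `∂q` read from any of its four corners, in either
orientation — a rotation of the plaquette word of `q` (§2.1: a cycle, first edge fixed arbitrarily) or of its inverse
path `(∂q)⁻¹`.  These are exactly the loops `u` with `u ⊖ₓ q = ∅`, i.e. the last loops of every vanishing trajectory.
[cite: Chatterjee2019LargeN, §2.1 (plaquettes as closed paths of length four; cycles; inverse path), §4 (a₁ = 1: ∂p ⊖ p = ∅)] -/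
def IsUnitLoop (q : ZdPlaquette d) (u : Word d) : Prop :=
  ∃ r : ℕ, u = (plaquetteWord q).rotate r ∨ u = (FreeGroup.invRev (plaquetteWord q)).rotate r

namespace IsUnitLoop

variable {q : ZdPlaquette d} {u : Word d}

/-- `∂q` itself is a unit loop. [cite: Chatterjee2019LargeN, §2.1] -/
theorem plaquetteWord (q : ZdPlaquette d) : IsUnitLoop q (Chatterjee2019LargeN.plaquetteWord q) :=
  ⟨0, Or.inl (List.rotate_zero _).symm⟩

/-- `(∂q)⁻¹` is a unit loop. [cite: Chatterjee2019LargeN, §2.1 (inverse path)] -/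
theorem invRev_plaquetteWord (q : ZdPlaquette d) :
    IsUnitLoop q (FreeGroup.invRev (Chatterjee2019LargeN.plaquetteWord q)) :=
  ⟨0, Or.inr (List.rotate_zero _).symm⟩

/-- Rotations of unit loops are unit loops. [cite: Chatterjee2019LargeN, §2.1 (cyclic equivalence)] -/
theorem rotate (h : IsUnitLoop q u) (k : ℕ) : IsUnitLoop q (u.rotate k) := by
  obtain ⟨r, hr | hr⟩ := h
  · exact ⟨r + k, Or.inl (by rw [hr, List.rotate_rotate])⟩
  · exact ⟨r + k, Or.inr (by rw [hr, List.rotate_rotate])⟩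

/-- Inverses of unit loops are unit loops. [cite: Chatterjee2019LargeN, §2.1 (inverse path)] -/
theorem invRev (h : IsUnitLoop q u) : IsUnitLoop q (FreeGroup.invRev u) := by
  obtain ⟨r, hr | hr⟩ := h
  · exact ⟨(Chatterjee2019LargeN.plaquetteWord q).length - r % (Chatterjee2019LargeN.plaquetteWord q).length,
      Or.inr (by rw [hr, invRev_rotate])⟩
  · refine ⟨(FreeGroup.invRev (Chatterjee2019LargeN.plaquetteWord q)).length
      - r % (FreeGroup.invRev (Chatterjee2019LargeN.plaquetteWord q)).length, Or.inl ?_⟩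
    rw [hr, invRev_rotate, FreeGroup.invRev_invRev]

/-- A unit loop has length four. [cite: Chatterjee2019LargeN, §2.1 («closed path of length four»)] -/
theorem length_eq (h : IsUnitLoop q u) : u.length = 4 := by
  obtain ⟨r, hr | hr⟩ := h
  · rw [hr, List.length_rotate, length_plaquetteWord]
  · rw [hr, List.length_rotate, FreeGroup.invRev_length, length_plaquetteWord]

/-- A unit loop is non-null. [cite: Chatterjee2019LargeN, §2.1] -/
theorem ne_nil (h : IsUnitLoop q u) : u ≠ [] := by
  intro h0
  have := h.length_eq
  rw [h0] at this
  simp at this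

/-- A unit loop is duplicate-free. [cite: Chatterjee2019LargeN, §2.2 (a plaquette contains each edge at most once)] -/
theorem nodup (h : IsUnitLoop q u) : u.Nodup := by
  obtain ⟨r, hr | hr⟩ := h
  · rw [hr, List.nodup_rotate]; exact plaquetteWord_nodup q
  · rw [hr, List.nodup_rotate]; exact invRev_plaquetteWord_nodup q

/-- The undirected edges of a unit loop are pairwise distinct. [cite: Chatterjee2019LargeN, §2.2] -/
theorem map_fst_nodup (h : IsUnitLoop q u) : (u.map Prod.fst).Nodup := by
  obtain ⟨r, hr | hr⟩ := h
  · rw [hr, List.map_rotate, List.nodup_rotate]; exact plaquetteWord_map_fst_nodup q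
  · rw [hr, List.map_rotate, List.nodup_rotate, map_fst_invRev, List.nodup_reverse]
    exact plaquetteWord_map_fst_nodup q

/-- `(∂q)⁻¹` is a (based) loop. [cite: Chatterjee2019LargeN, §2.1 (the inverse of a closed nonbacktracking path)] -/
theorem _root_.Literature.MathematicalPhysics.QuantumFieldTheory.Chatterjee2019LargeN.isLoop_invRev_plaquetteWord
    (q : ZdPlaquette d) : IsLoop (FreeGroup.invRev (Chatterjee2019LargeN.plaquetteWord q)) := by
  obtain ⟨x, ⟨⟨i, j⟩, hij⟩⟩ := q
  have hne : i ≠ j := ne_of_lt hij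
  refine ⟨⟨?_, ?_⟩, ?_, ?_⟩
  · simp [IsPath, Chatterjee2019LargeN.plaquetteWord, FreeGroup.invRev, DEdge.src, DEdge.tgt, add_right_comm]
  · intro h
    simp [Chatterjee2019LargeN.plaquetteWord, FreeGroup.invRev, DEdge.src, DEdge.tgt]
  · simp [FreeGroup.IsReduced, Chatterjee2019LargeN.plaquetteWord, FreeGroup.invRev, hne, hne.symm]
  · simp [Chatterjee2019LargeN.plaquetteWord, FreeGroup.invRev, hne.symm]

/-- A unit loop is a loop. [cite: Chatterjee2019LargeN, §2.1 (plaquettes are loops; cyclic equivalence)] -/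
theorem isLoop (h : IsUnitLoop q u) : IsLoop u := by
  obtain ⟨r, hr | hr⟩ := h
  · rw [hr]; exact (isLoop_plaquetteWord q).rotate r
  · rw [hr]; exact (isLoop_invRev_plaquetteWord q).rotate r

/-- The one-loop sequence `(u)` of a unit loop is a genuine loop sequence. [cite: Chatterjee2019LargeN, §2.1] -/
theorem isLoopSeq (h : IsUnitLoop q u) : IsLoopSeq [u] := fun l hl => by
  rw [List.mem_singleton] at hl
  subst hl
  exact ⟨h.isLoop, h.ne_nil⟩

/-- The 1-chain of a unit loop is `±δq`. [cite: Chatterjee2019LargeN, §3 (r(l) is invariant under cyclic equivalence; r(ρ⁻¹) = −r(ρ))] -/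
theorem wordChain_eq (h : IsUnitLoop q u) : ∃ τ : ℤ, (τ = 1 ∨ τ = -1) ∧ wordChain u = τ • plaquetteChain q := by
  obtain ⟨r, hr | hr⟩ := h
  · exact ⟨1, Or.inl rfl, by rw [hr, wordChain_rotate, one_smul, plaquetteChain]⟩
  · exact ⟨-1, Or.inr rfl, by rw [hr, wordChain_rotate, wordChain_invRev, plaquetteChain, neg_one_smul]⟩

/-- Every letter of a unit loop of `q` lies on an edge of `q`. [cite: Chatterjee2019LargeN, §2.1] -/
theorem fst_mem_plaquetteEdges (h : IsUnitLoop q u) {f : DEdge d} (hf : f ∈ u) : f.1 ∈ plaquetteEdges q := by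
  obtain ⟨r, hr | hr⟩ := h
  · rw [hr, List.mem_rotate] at hf
    exact fst_mem_plaquetteEdges_of_mem hf
  · rw [hr, List.mem_rotate, mem_invRev_iff] at hf
    exact fst_mem_plaquetteEdges_of_mem (f := DEdge.inv f) hf

/-- Hence `q ∈ 𝒫⁺(f)` for every letter `f` of a unit loop of `q`. [cite: Chatterjee2019LargeN, §2.2 (𝒫⁺(e))] -/
theorem mem_plaquettesAt (h : IsUnitLoop q u) {f : DEdge d} (hf : f ∈ u) : q ∈ plaquettesAt f := by
  rw [plaquettesAt, mem_plaquettesTouching_iff]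
  exact ⟨f.1, Finset.mem_inter.2 ⟨h.fst_mem_plaquetteEdges hf, Finset.mem_singleton_self _⟩⟩

/-- Two letters of a unit loop on the same undirected edge are equal. [cite: Chatterjee2019LargeN, §2.2] -/
theorem eq_of_fst_eq (h : IsUnitLoop q u) {a f : DEdge d} (ha : a ∈ u) (hf : f ∈ u) (e : a.1 = f.1) : a = f :=
  List.inj_on_of_nodup_map h.map_fst_nodup ha hf e

/-! ### The key computation: deforming by `q` at a letter of a unit loop of `q` glues the unit loop in -/

/-- For a unit loop `U` of `q` and a letter `f = U_j`, the plaquette word of `q` rotated to the location of the edge of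
`f` is either `U` read from `j` (when `U` is positively oriented) or the inverse of `U` read from just after `j`
(when `U` is negatively oriented): in both cases, with `U ↻ j = f r`, it is `f r` or `f⁻¹ r⁻¹`.
[cite: Chatterjee2019LargeN, §2.2 (l ⊕ₓ p: «let y be the unique location in p of e or e⁻¹»; the two cases of the merger)] -/
theorem rotate_plaquetteLoc_eq {U : Word d} (hU : IsUnitLoop q U) (j : Fin U.length) :
    (Chatterjee2019LargeN.plaquetteWord q).rotate (Word.plaquetteLoc q (U.get j).1) = U.get j :: (U.rotate j).drop 1 ∨
    (Chatterjee2019LargeN.plaquetteWord q).rotate (Word.plaquetteLoc q (U.get j).1)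
      = DEdge.inv (U.get j) :: FreeGroup.invRev ((U.rotate j).drop 1) := by
  set f := U.get j with hf
  have hfU : f ∈ U := List.get_mem U j
  have hq : q ∈ plaquettesAt f := hU.mem_plaquettesAt hfU
  obtain ⟨a, d', hrot, ha⟩ := Word.rotate_plaquetteLoc_eq_cons hq
  have haq : a ∈ Chatterjee2019LargeN.plaquetteWord q := by
    rw [← List.mem_rotate (n := Word.plaquetteLoc q f.1), hrot]; exact List.mem_cons_self
  have hUj : U.rotate j = f :: (U.rotate j).drop 1 := Word.rotate_eq_letter_cons_drop U j
  obtain ⟨r, hr | hr⟩ := hU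
  · -- positively oriented: `a = f` and both words are rotations of `∂q` with head `f`
    left
    have hfq : f ∈ Chatterjee2019LargeN.plaquetteWord q := by rw [hr, List.mem_rotate] at hfU; exact hfU
    have haf : a = f := eq_of_mem_plaquetteWord_of_fst_eq haq hfq ha
    subst haf
    have h1 : ∀ n : ℕ, U.rotate n = (Chatterjee2019LargeN.plaquetteWord q).rotate (r + n) := fun n => by
      rw [hr, List.rotate_rotate]
    rw [h1] at hUj
    have h3 := rotate_eq_rotate_of_head (plaquetteWord_nodup q) hrot hUj
    rw [h3, hUj, ← h1]
  · -- negatively oriented: `a = f⁻¹`; `(f⁻¹ d')⁻¹ ↻ 3 = f d'⁻¹` and `U ↻ j` are rotations of `(∂q)⁻¹` with head `f`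
    right
    have hfq : DEdge.inv f ∈ Chatterjee2019LargeN.plaquetteWord q := by
      rw [hr, List.mem_rotate, mem_invRev_iff] at hfU; exact hfU
    have haf : a = DEdge.inv f := eq_of_mem_plaquetteWord_of_fst_eq haq hfq ha
    subst haf
    have hlen : d'.length = 3 := by
      have := congrArg List.length hrot
      rw [List.length_rotate, length_plaquetteWord, List.length_cons] at this
      omega
    have h2 : (FreeGroup.invRev ((Chatterjee2019LargeN.plaquetteWord q).rotate (Word.plaquetteLoc q f.1))).rotate 3
        = f :: FreeGroup.invRev d' := by
      rw [hrot, show DEdge.inv f :: d' = [DEdge.inv f] ++ d' from rfl, FreeGroup.invRev_append,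
        show FreeGroup.invRev [DEdge.inv f] = [f] from by simp [FreeGroup.invRev, DEdge.inv], ← hlen,
        ← FreeGroup.invRev_length (L₁ := d'), List.rotate_append_length_eq]
      rfl
    rw [invRev_rotate, List.rotate_rotate] at h2
    have h1 : ∀ n : ℕ, U.rotate n = (FreeGroup.invRev (Chatterjee2019LargeN.plaquetteWord q)).rotate (r + n) :=
      fun n => by rw [hr, List.rotate_rotate]
    rw [h1] at hUj
    have h3 := rotate_eq_rotate_of_head (invRev_plaquetteWord_nodup q) h2 hUj
    rw [h2, hUj] at h3
    have h4 : FreeGroup.invRev d' = (U.rotate j).drop 1 := by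
      rw [h1]; exact (List.cons.inj h3).2
    rw [hrot, ← h4, FreeGroup.invRev_invRev]

/-- ★ **Negative deformation by `q` at a letter of a unit loop of `q`**: if `w` read from `x` is `f t` and the unit loop
`U` of `q` read from its letter `f = U_j` is `f r`, then `w ⊖ₓ q = [r⁻¹ t]` — both orientation cases of §2.2's
`l ⊖ₓ p` («if l = aeb, l' = ced then [a c⁻¹ d⁻¹ b]; if l' = c e⁻¹ d then [a d c b]») in one formula.
[cite: Chatterjee2019LargeN, §2.2 (negative merger and negative deformation, both cases)] -/
theorem negDeform_eq {U : Word d} (hU : IsUnitLoop q U) (j : Fin U.length) {w : Word d} (x : Fin w.length)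
    {t : Word d} (hw : w.rotate x = U.get j :: t) :
    Word.negDeform w x q = core (FreeGroup.invRev ((U.rotate j).drop 1) ++ t) := by
  have hletter : w.letter x = U.get j := by
    have h := Word.rotate_eq_letter_cons_drop w x
    rw [hw] at h
    exact (List.cons.inj h).1.symm
  rw [Word.negDeform, hletter, hw]
  rcases hU.rotate_plaquetteLoc_eq j with h | h
  · rw [h, Word.negMergeRot, if_pos rfl]
  · rw [h, Word.negMergeRot, if_neg (by simp [DEdge.inv])]

/-- ★ **Positive deformation by `q` at a letter of a unit loop of `q`**: with notation as in `negDeform_eq`,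
`w ⊕ₓ q = [f r f t]`. [cite: Chatterjee2019LargeN, §2.2 (positive merger and positive deformation, both cases)] -/
theorem posDeform_eq {U : Word d} (hU : IsUnitLoop q U) (j : Fin U.length) {w : Word d} (x : Fin w.length)
    {t : Word d} (hw : w.rotate x = U.get j :: t) :
    Word.posDeform w x q = core (U.get j :: (U.rotate j).drop 1 ++ U.get j :: t) := by
  have hletter : w.letter x = U.get j := by
    have h := Word.rotate_eq_letter_cons_drop w x
    rw [hw] at h
    exact (List.cons.inj h).1.symm
  rw [Word.posDeform, hletter, hw]
  rcases hU.rotate_plaquetteLoc_eq j with h | h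
  · rw [h, Word.posMergeRot, if_pos rfl]
  · rw [h, Word.posMergeRot, if_neg (by simp [DEdge.inv]), FreeGroup.invRev_invRev]

/-- The 1-chain of `w ⊖ₓ q` in the situation of `negDeform_eq`: `r(w ⊖ₓ q) = r(w) − r(U)`.
[cite: Chatterjee2019LargeN, §14 (proof of Lemma 14.1: r(l ⊖ l') = r(l) ∓ r(l'))] -/
theorem wordChain_negDeform {U : Word d} (hU : IsUnitLoop q U) (j : Fin U.length) {w : Word d} (x : Fin w.length)
    {t : Word d} (hw : w.rotate x = U.get j :: t) :
    wordChain (Word.negDeform w x q) = wordChain w - wordChain U := by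
  have hU' : wordChain U = edgeChain (U.get j) + wordChain ((U.rotate j).drop 1) := by
    rw [← wordChain_rotate U j]
    conv_lhs => rw [Word.rotate_eq_letter_cons_drop U j]
    rw [wordChain_cons, Word.letter]
  have hw' : wordChain w = edgeChain (U.get j) + wordChain t := by
    rw [← wordChain_rotate w x, hw, wordChain_cons]
  rw [hU.negDeform_eq j x hw, wordChain_core, wordChain_append, wordChain_invRev, hU', hw']
  abel

/-- The 1-chain of `w ⊕ₓ q` in the situation of `posDeform_eq`: `r(w ⊕ₓ q) = r(w) + r(U)`.
[cite: Chatterjee2019LargeN, §14 (proof of Lemma 14.1: r(l ⊕ l') = r(l) ± r(l'))] -/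
theorem wordChain_posDeform {U : Word d} (hU : IsUnitLoop q U) (j : Fin U.length) {w : Word d} (x : Fin w.length)
    {t : Word d} (hw : w.rotate x = U.get j :: t) :
    wordChain (Word.posDeform w x q) = wordChain w + wordChain U := by
  have hU' : wordChain U = edgeChain (U.get j) + wordChain ((U.rotate j).drop 1) := by
    rw [← wordChain_rotate U j]
    conv_lhs => rw [Word.rotate_eq_letter_cons_drop U j]
    rw [wordChain_cons, Word.letter]
  have hw' : wordChain w = edgeChain (U.get j) + wordChain t := by
    rw [← wordChain_rotate w x, hw, wordChain_cons]
  rw [hU.posDeform_eq j x hw, wordChain_core, wordChain_append, wordChain_cons, wordChain_cons, hU', hw']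
  abel

/-- **`u ⊖ₓ q = ∅`** at every location of a unit loop `u` of `q` («`∂p ⊖ p = ∅`»: `[r⁻¹ r] = ∅`).
[cite: Chatterjee2019LargeN, §4 (a₁ = 1), §2.2] -/
theorem negDeform_self (h : IsUnitLoop q u) (x : Fin u.length) : Word.negDeform u x q = [] := by
  rw [h.negDeform_eq x x (Word.rotate_eq_letter_cons_drop u x), core,
    FreeGroup.reduce.eq_of_red (red_invRev_append_self _)]
  exact core_nil

/-- **`u ⊕ₓ q ≠ ∅`** for a unit loop `u` of `q` (its 1-chain is `2r(u) = ±2δq ≠ 0`). [cite: Chatterjee2019LargeN, §2.2, §14] -/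
theorem posDeform_self_ne_nil (h : IsUnitLoop q u) (x : Fin u.length) : Word.posDeform u x q ≠ [] := by
  intro h0
  have hc := h.wordChain_posDeform x x (Word.rotate_eq_letter_cons_drop u x)
  rw [h0, wordChain_nil] at hc
  obtain ⟨τ, hτ, hu⟩ := h.wordChain_eq
  rw [hu, ← add_smul] at hc
  have h2 : (τ + τ) • plaquetteChain q = 0 := hc.symm
  rw [smul_eq_zero] at h2
  rcases h2 with h2 | h2
  · rcases hτ with rfl | rfl <;> norm_num at h2
  · exact plaquetteChain_ne_zero q h2

end IsUnitLoop

/-! ### First-order coefficients: `a₁((u)) = 1` on unit loops, `a₁((u)) = 0` off the unit 1-chains -/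

/-- ★ **`a₁((u)) = 0` when `r(u) ≠ ±δq` for every plaquette `q`** (genuine non-null loop `u`): by
`|u|·a₁((u)) = #{null u ⊖ₓ q} − #{null u ⊕ₓ q}` (Corollary 10.4 at `k = 1`) and §14's bookkeeping `r(u ⊖ₓ q) = r(u) ∓ δq`,
`r(u ⊕ₓ q) = r(u) ± δq`, no single deformation of `u` is null. [cite: Chatterjee2019LargeN, Corollary 10.4 (k = 1), Lemma 11.3, §14 (proof of Lemma 14.1)] -/
theorem coeffA_singleton_one_eq_zero_of_wordChain {u : Word d} (hl : IsLoop u) (hne : u ≠ [])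
    (hr : ∀ (q : ZdPlaquette d) (σ : ℤ), σ = 1 ∨ σ = -1 → wordChain u ≠ σ • plaquetteChain q) :
    coeffA [u] 1 = 0 := by
  classical
  have h := length_mul_coeffA_singleton_one hl hne
  have h1 : (Finset.univ.filter fun o : DeformIdx [u] => Word.negDeform ([u].get o.1) o.2.1 o.2.2.1 = []).card = 0 := by
    rw [Finset.card_eq_zero, Finset.filter_eq_empty_iff]
    rintro ⟨⟨i, hi⟩, x, q, hq⟩ - h0
    have hi0 : i = 0 := by simp only [List.length_singleton] at hi; omega
    subst hi0
    obtain ⟨σ, hσ, hc⟩ := Word.wordChain_negDeform u x hq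
    change Word.negDeform u x q = [] at h0
    rw [h0, wordChain_nil] at hc
    refine hr q (-σ) (by rcases hσ with rfl | rfl <;> simp) ?_
    rw [neg_smul, eq_neg_iff_add_eq_zero]
    exact hc.symm
  have h2 : (Finset.univ.filter fun o : DeformIdx [u] => Word.posDeform ([u].get o.1) o.2.1 o.2.2.1 = []).card = 0 := by
    rw [Finset.card_eq_zero, Finset.filter_eq_empty_iff]
    rintro ⟨⟨i, hi⟩, x, q, hq⟩ - h0
    have hi0 : i = 0 := by simp only [List.length_singleton] at hi; omega
    subst hi0
    obtain ⟨σ, hσ, hc⟩ := Word.wordChain_posDeform u x hq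
    change Word.posDeform u x q = [] at h0
    rw [h0, wordChain_nil] at hc
    refine hr q (-σ) (by rcases hσ with rfl | rfl <;> simp) ?_
    rw [neg_smul, eq_neg_iff_add_eq_zero]
    exact hc.symm
  rw [h1, h2] at h
  simp only [Nat.cast_zero, sub_zero, mul_eq_zero, Nat.cast_eq_zero] at h
  rcases h with h | h
  · exact absurd (List.length_eq_zero_iff.1 h) hne
  · exact h

/-- ★ **`a₁((u)) = 1` for every unit loop `u`** — §4's «`a₁ = 1`» for the plaquette read from any corner in either
orientation: the null single deformations of `u` are exactly the four `u ⊖ₓ q` (`negDeform_self`; a null deformation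
by `q'` forces `±δq ± δq' = 0`, i.e. `q' = q`, and `u ⊕ₓ q` has `r = 2r(u) ≠ 0`), so `4·a₁ = 4`.
[cite: Chatterjee2019LargeN, §4 (last paragraph: a₁ = 1), Corollary 10.4 (k = 1), §14] -/
theorem IsUnitLoop.coeffA_one {q : ZdPlaquette d} {u : Word d} (h : IsUnitLoop q u) : coeffA [u] 1 = 1 := by
  classical
  have hl := h.isLoop
  have hne := h.ne_nil
  have hlen := h.length_eq
  obtain ⟨τ, hτ, hu⟩ := h.wordChain_eq
  have hmain := length_mul_coeffA_singleton_one hl hne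
  -- a null deformation by `q'` forces `q' = q`
  have key : ∀ (x : Fin u.length) (q' : ZdPlaquette d) (σ : ℤ), (σ = 1 ∨ σ = -1) →
      wordChain u + σ • plaquetteChain q' = 0 → q' = q := by
    intro x q' σ hσ hc
    rw [hu] at hc
    have h' : plaquetteChain q = (-(τ * σ)) • plaquetteChain q' := by
      have hτ2 : τ * τ = 1 := by rcases hτ with rfl | rfl <;> norm_num
      have := congrArg (fun c => τ • c) hc
      simp only [smul_add, smul_smul, hτ2, one_smul, smul_zero] at this
      rw [neg_smul, eq_neg_iff_add_eq_zero]
      exact this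
    exact (PlaquetteFirstOrderProof.eq_of_plaquetteChain_eq_smul
      (by rcases hτ with rfl | rfl <;> rcases hσ with rfl | rfl <;> simp) h').symm
  -- no positive deformation of `u` is null
  have h2 : (Finset.univ.filter fun o : DeformIdx [u] => Word.posDeform ([u].get o.1) o.2.1 o.2.2.1 = []).card = 0 := by
    rw [Finset.card_eq_zero, Finset.filter_eq_empty_iff]
    rintro ⟨⟨i, hi⟩, x, q', hq'⟩ - h0
    have hi0 : i = 0 := by simp only [List.length_singleton] at hi; omega
    subst hi0
    change Word.posDeform u x q' = [] at h0
    obtain ⟨σ, hσ, hc⟩ := Word.wordChain_posDeform u x hq'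
    rw [h0, wordChain_nil] at hc
    have hq : q' = q := key x q' σ hσ hc.symm
    subst hq
    exact h.posDeform_self_ne_nil x h0
  -- exactly the four `u ⊖ₓ q` are null
  have h1 : (Finset.univ.filter fun o : DeformIdx [u] => Word.negDeform ([u].get o.1) o.2.1 o.2.2.1 = []).card = 4 := by
    let f : Fin u.length → DeformIdx [u] :=
      fun x => ⟨⟨0, Nat.zero_lt_one⟩, x, ⟨q, h.mem_plaquettesAt (List.get_mem u x)⟩⟩
    have hf : Function.Injective f := by
      intro a b hab
      simp only [f, Sigma.mk.injEq, heq_eq_eq, true_and] at hab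
      exact hab.1
    have hset : (Finset.univ.filter fun o : DeformIdx [u] =>
        Word.negDeform ([u].get o.1) o.2.1 o.2.2.1 = []) = Finset.univ.map ⟨f, hf⟩ := by
      ext o
      simp only [Finset.mem_filter, Finset.mem_univ, true_and, Finset.mem_map, Function.Embedding.coeFn_mk]
      constructor
      · intro ho
        obtain ⟨⟨i, hi⟩, x, q', hq'⟩ := o
        have hi0 : i = 0 := by simp only [List.length_singleton] at hi; omega
        subst hi0
        change Word.negDeform u x q' = [] at ho
        obtain ⟨σ, hσ, hc⟩ := Word.wordChain_negDeform u x hq'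
        rw [ho, wordChain_nil] at hc
        have hq : q' = q := key x q' σ hσ hc.symm
        subst hq
        exact ⟨x, rfl⟩
      · rintro ⟨x, rfl⟩
        exact h.negDeform_self x
    rw [hset, Finset.card_map, Finset.card_univ, Fintype.card_fin, hlen]
  rw [h1, h2, hlen] at hmain
  norm_num at hmain
  linarith

/-- ★ **`a₂((u₁, u₂)) = 1` for unit loops `u₁, u₂`**: by the factorization of §13 (`a₂(u₁,u₂) = Σ_{i+j=2} a_i(u₁)a_j(u₂)`),
Lemma 11.3 (`a₀ = 0` for a non-null loop) and `a₁ = 1`. [cite: Chatterjee2019LargeN, §13 (Corollary 3.2 in coefficient form), Lemma 11.3, §4] -/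
theorem coeffA_pair_two {q₁ q₂ : ZdPlaquette d} {u₁ u₂ : Word d} (h₁ : IsUnitLoop q₁ u₁) (h₂ : IsUnitLoop q₂ u₂) :
    coeffA [u₁, u₂] 2 = 1 := by
  have hn₁ : ∀ l ∈ [u₁], l ≠ [] := fun l hl => by rw [List.mem_singleton] at hl; exact hl ▸ h₁.ne_nil
  have hn₂ : ∀ l ∈ [u₂], l ≠ [] := fun l hl => by rw [List.mem_singleton] at hl; exact hl ▸ h₂.ne_nil
  have h := Factorization.coeffA_append hn₁ hn₂ 2
  rw [List.singleton_append] at h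
  rw [h, Finset.Nat.sum_antidiagonal_eq_sum_range_succ (fun i j => coeffA [u₁] i * coeffA [u₂] j)]
  simp only [Finset.sum_range_succ, Finset.sum_range_zero, zero_add,
    coeffA_zero_of_ne_nil h₁.isLoopSeq (List.cons_ne_nil _ _), coeffA_zero_of_ne_nil h₂.isLoopSeq (List.cons_ne_nil _ _),
    h₁.coeffA_one, h₂.coeffA_one]
  norm_num

end Literature.MathematicalPhysics.QuantumFieldTheory.Chatterjee2019LargeN

end
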